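import Summits.Ventures.PercRepro2.CaseOneResidualDegree

/-!
# The residual class, characterised
(blind cell PercRepro2, p1 g22; the converse of `CaseOneResidualDegree`)

`residual_iff`: a graph is residual for the statement vertex `v` (no thickening step applies —
`Residual`) **iff** it has no loop, no parallel pair, and every vertex `w ∉ {o, a₁, a₂, v, b}` has
degree `≠ 1` and `≠ 2`. The forward direction is `CaseOneResidualDegree`; for the converse, each of the
four thickening steps exhibits a loop, a parallel pair, a leaf (degree one) or a series vertex (degree
two). Hence `closedAt_of_residual` reads: the four forms for every weight vector on every loopless,
parallel-free graph whose unmarked non-statement vertices have degree `0` or `≥ 3` give them on every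
finite graph. Own code; standard axioms. -/

namespace Summit.Ventures.PercRepro2

namespace CaseOne

universe u

section Iff
variable {V : Type*} [DecidableEq V] {E : Type u} [Fintype E] [DecidableEq E]
variable {o a₁ a₂ b v : V} {ends : E → Sym2 V}

omit [DecidableEq E] in
/-- A leaf has degree one. -/
lemma degree_eq_one_of_leaf {u a₃ : V} {e₀ : E} (hl : IsLeafAt ends u a₃ e₀) : degree ends a₃ = 1 := by
  unfold degree
  rw [Finset.card_eq_one]
  refine ⟨e₀, ?_⟩
  ext e
  rw [mem_edgesAt, Finset.mem_singleton]
  constructor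
  · exact hl.unique e
  · rintro rfl
    rw [hl.ends_eq]
    exact Sym2.mem_mk_right u a₃

/-- A series vertex has degree two. -/
lemma degree_eq_two_of_series {x w z : V} {e₀ e₁ : E} (hs : IsSeriesAt ends x w z e₀ e₁) :
    degree ends w = 2 := by
  unfold degree
  rw [Finset.card_eq_two]
  refine ⟨e₀, e₁, hs.ne, ?_⟩
  ext e
  rw [mem_edgesAt, Finset.mem_insert, Finset.mem_singleton]
  constructor
  · exact hs.unique e
  · rintro (rfl | rfl)
    · rw [hs.ends_zero]
      exact Sym2.mem_mk_right x w
    · rw [hs.ends_one]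
      exact Sym2.mem_mk_left w z

/-- **The residual class**: no thickening step applies iff there is no loop, no parallel pair, and every
vertex `w ∉ {o, a₁, a₂, v, b}` has degree `≠ 1` and `≠ 2`. -/
theorem residual_iff :
    Residual o a₁ a₂ b v E ends ↔
      (∀ (e : E) (x : V), ends e ≠ s(x, x)) ∧ (∀ e₀ e₁ : E, e₀ ≠ e₁ → ends e₀ ≠ ends e₁) ∧
        (∀ w : V, o ≠ w → a₁ ≠ w → a₂ ≠ w → v ≠ w → b ≠ w →
          degree ends w ≠ 1 ∧ degree ends w ≠ 2) := by
  constructor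
  · intro h
    exact ⟨fun e x => h.not_loop e x, fun e₀ e₁ hne => h.not_parallel hne,
      fun w ho h1 h2 hv hb => ⟨h.degree_ne_one ho h1 h2 hv hb, h.degree_ne_two ho h1 h2 hv hb⟩⟩
  · rintro ⟨hloop, hpar, hdeg⟩ ⟨E', _, _, ends', hstep⟩
    cases hstep with
    | leaf E ends u a₃ e₀ hl ho h1 h2 hv hb =>
      exact (hdeg a₃ ho h1 h2 hv hb).1 (degree_eq_one_of_leaf hl)
    | par E ends e₀ e₁ hp hne => exact hpar e₀ e₁ hne hp
    | series E ends x w z e₀ e₁ hs ho h1 h2 hv hb =>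
      exact (hdeg w ho h1 h2 hv hb).2 (degree_eq_two_of_series hs)
    | loop E ends x e₀ hl => exact hloop e₀ x hl

end Iff

end CaseOne

end Summit.Ventures.PercRepro2
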